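import Summits.BirchSwinnertonDyer.Rank1Residual.X12.O11.RouteUTraceForm
import Summits.BirchSwinnertonDyer.BirchSwinnertonDyer.Theorems.PrintCFramBottomClassIndexLawFiveLeAnchorReduction
import Summits.BirchSwinnertonDyer.Rank1Residual.P2.CMKolyvaginTamagawaIndexOddHeegnerBases
import HarnessLib

/-!
# Crux `PrintCFram.BottomClassIndexLawFiveLe` (stmt-BirchSwinnertonDyer-20372), class `(163, j(A(163)))` of the anchor side:
# the EISENSTEIN TRACE FORM of Gross's curve `A(163)` in the kernel — `a_ℓ(A(163)) ≡ ℓ⁴¹ + ℓ¹²² (mod 163)` for every prime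
# `ℓ ≠ 163` (Buhler–Gross 1985 (4.3) with `k = (3·163−1)/4 = 122`; Gross LNM 776 Thm. 13.1.2: `A(p)[𝔭] ≅ μ_p^{⊗k}`) — PROVED,
# not cited, by cell `bsd-cm`'s Mazur-1978 route for `a_ℓ(49a1) ≡ ℓ² + ℓ⁵ (mod 7)` (`RouteU.lFunction_cm7_mod_seven`):
# the trace-form input `a_ℓ ≡ ψ(ℓ) + ψ⁻¹ω(ℓ)`, `ψ = ω¹²²`, of Kriz–Li 2019 Thm. 1.20 at `p = 163` (cell `bsd-print-cfram`, width seat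
# `bsd-line-cfram-p1-w2`; THEOREMS ONLY, `--supports` 20372; nothing asserted about BSD; BSD is not proved by any of this)

HONEST FRAMING. Third brick (after the two kernel Bernoulli certificates `‖B_{1,ω^{121}}‖_{163} = 1`, `‖B_{1,χ_{−7}ω^{40}}‖_{163} = 1`)
towards cell `bsd-cm`'s Route U^{(163)} for `A(163) = cm163 = 26569a1`, the one class of `stub_unitAnchor` beyond the printed
`N < 5000` theorem. The proof is the cell's (E49) argument verbatim at `p = 163`: `A(163)[163]` is reducible
(`X12.not_irr_of_hasCM_of_dvd_cmFieldDiscrOfJ`: CM by `ℚ(√−163)`, `163 ∣ d_K`); the isogeny character of the `Γ_ℚ`-stable line is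
unramified outside `163` (good reduction away from `163`: `Δ_min = −163³`), hence a power `χ̄₁₆₃ᵏ` of the mod-`163` cyclotomic
character (`ℚ` has no unramified abelian extension; `Mazur1978.exists_forall_eq_mul_modNCyclotomicCharacter_pow`); Mazur's
Prop. 6.3 (1) gives `a_q ≡ qᵏ + q·q⁻ᵏ (mod 163)` at every good `q`; and `a₂(A(163)) = 0` (kernel point count `#Ẽ(𝔽₂) = 3`)
pins `k mod 162 ∈ {41, 122}` (a 162-case kernel check; `2` is a primitive root mod `163`). So
`lFunction_cm163_mod : (a_ℓ : ZMod 163) = ℓ⁴¹ + ℓ¹²²` for every prime `ℓ ≠ 163`. beyond-print theorem: NO (Buhler–Gross (4.3)).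

References: [Mazur1978] §5 (p. 148), Prop. 6.3 (1) (p. 153); [BuhlerGross1985] Ch. I (4.3) (p. 14); [Gross1980] Thm. 13.1.2;
[Cremona1997] Table 1 (26569a1 is beyond the table; the model is Silverman *AT* App. A §3, `Δ = −163³`);
[SilvermanATAEC1994] App. A §3.
-/

noncomputable section

-- summit-side namespace `Summit.BirchSwinnertonDyer.BirchSwinnertonDyer.…` (single-conjunct summit, D-0017 layout)
set_option linter.dupNamespace false

open scoped Classical
open NumberField IsDedekindDomain IsDedekindDomain.HeightOneSpectrum Field WeierstrassCurve
open Literature.NumberTheory.EllipticCurves Literature.NumberTheory.GaloisRepresentations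
open Literature.NumberTheory.EllipticCurves.Rank1Residual
open Summit.BirchSwinnertonDyer.Rank1Residual

namespace Summit.BirchSwinnertonDyer.BirchSwinnertonDyer.Theorems.PrintCFram.AnchorReduction

/-! ## §1 Local data of `A(163)`: good reduction away from `163`, `a₂ = 0` -/

/-- `A(163) = cm163` has good reduction at every prime `ℓ ≠ 163` (`Δ_min = −163³`). [cite: SilvermanATAEC1994, App. A §3 (row D = −163)] -/
theorem hasGoodReductionAtPrime_cm163 (ℓ : ℕ) [hℓ : Fact ℓ.Prime] (h : ℓ ≠ 163) :
    cm163.HasGoodReductionAtPrime ℓ := by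
  haveI : cm163.IsGloballyMinimal := P2.OddHeegnerTwists.isGloballyMinimal_cm163
  have hI : integralModelInt cm163 = ⟨0, 0, 1, -2174420, 1234136692⟩ := P2.OddHeegnerTwists.integralModelInt_cm163
  have hmin : minimalDiscriminantInt cm163 = -((163 : ℕ) : ℤ) ^ 3 := by
    rw [Summit.BirchSwinnertonDyer.BirchSwinnertonDyer.Rank1Residual.IntModel.minimalDiscriminantInt_eq hI]
    exact P2.OddHeegnerTwists.Δ_cm163_int
  refine hasGoodReductionAtPrime_of_not_dvd cm163 ℓ ?_
  rw [hmin, dvd_neg]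
  intro hd
  have h' : (ℓ : ℤ) ∣ ((163 : ℕ) : ℤ) := (Nat.prime_iff_prime_int.mp hℓ.out).dvd_of_dvd_pow hd
  have h'' : ℓ ∣ 163 := by exact_mod_cast h'
  exact h ((Nat.prime_dvd_prime_iff_eq hℓ.out (by norm_num)).mp h'')

/-- Good reduction of `A(163)` at a finite place `v ∌ 163` of `ℚ`. [folklore] -/
theorem hasGoodReductionAt_cm163 {v : HeightOneSpectrum (𝓞 ℚ)} (hv : ((163 : ℕ) : 𝓞 ℚ) ∉ v.asIdeal) :
    cm163.HasGoodReductionAt v := by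
  haveI := Fact.mk (Rat.HeightOneSpectrum.primesEquiv v).2
  have h : (Rat.HeightOneSpectrum.primesEquiv v : ℕ) ≠ 163 := by
    intro h
    apply hv
    rw [DeuringLadic.natCast_mem_asIdeal_iff, h]
  exact (hasGoodReductionAtPrime_iff_hasGoodReductionAt_ringOfIntegers v cm163).mp
    (hasGoodReductionAtPrime_cm163 _ h)

/-- `a₂(A(163)) = 0`: the reduction of `[0, 0, 1, −2174420, 1234136692]` mod `2` is `y² + y = x³`, with `#Ẽ(𝔽₂) = 3` (kernel point
count). [cite: SilvermanATAEC1994, App. A §3 (row D = −163)] -/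
theorem frobeniusTrace_cm163_two :
    (haveI := P2.OddHeegnerTwists.isGloballyMinimal_cm163; cm163.frobeniusTrace 2) = 0 := by
  haveI : cm163.IsGloballyMinimal := P2.OddHeegnerTwists.isGloballyMinimal_cm163
  have hI : integralModelInt cm163 = ⟨0, 0, 1, -2174420, 1234136692⟩ := P2.OddHeegnerTwists.integralModelInt_cm163
  have hcnt : Nat.card (((⟨0, 0, 1, -2174420, 1234136692⟩ : WeierstrassCurve ℤ).map
      (Int.castRingHom (ZMod 2))).toAffine.Point) = 3 := by
    rw [@natCard_point_eq_one_add_card (ZMod 2) (@ZMod.instField 2 ⟨by norm_num⟩) _ _ _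
      (by decide +kernel)]
    decide +kernel
  rw [Summit.BirchSwinnertonDyer.BirchSwinnertonDyer.Rank1Residual.IntModel.frobeniusTrace_eq hI hcnt]
  norm_num

/-! ## §2 Arithmetic in `𝔽₁₆₃` -/

/-- The finite check pinning the exponent: `2ᵐ + 2·2^{161m mod 162} = 0` in `𝔽₁₆₃` with `m < 162` forces `m ∈ {41, 122}`
(`a₂(A(163)) = 0`; `y⁻¹ = y¹⁶¹` in `𝔽₁₆₃ˣ`; `2` is a primitive root mod `163`). [folklore] -/
theorem two_pow_add_eq_zero_cases_163 :
    ∀ m : ℕ, m < 162 → (2 : ZMod 163) ^ m + 2 * (2 : ZMod 163) ^ (161 * m % 162) = 0 → m = 41 ∨ m = 122 := by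
  decide +kernel

/-- In `𝔽₁₆₃`: `y⁻¹ = y¹⁶¹` for `y ≠ 0`. [folklore] -/
theorem inv_eq_pow_zmod163 {y : ZMod 163} (hy : y ≠ 0) : y⁻¹ = y ^ 161 := by
  haveI : Fact (Nat.Prime 163) := ⟨by norm_num⟩
  have h : y ^ 162 = 1 := ZMod.pow_card_sub_one_eq_one hy
  rw [inv_eq_of_mul_eq_one_right (a := y) (b := y ^ 161) (by rw [← pow_succ']; exact h)]

/-- A prime `q ≠ 163` is a unit mod `163`: `q¹⁶² = 1` in `𝔽₁₆₃`. [folklore] -/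
theorem natCast_pow_zmod163 {q : ℕ} (hq : q.Prime) (h : q ≠ 163) : (q : ZMod 163) ^ 162 = 1 := by
  haveI : Fact (Nat.Prime 163) := ⟨by norm_num⟩
  have hq0 : (q : ZMod 163) ≠ 0 := by
    rw [Ne, ZMod.natCast_eq_zero_iff]
    exact fun hd => h ((Nat.prime_dvd_prime_iff_eq (by norm_num) hq).mp hd).symm
  exact ZMod.pow_card_sub_one_eq_one hq0

/-! ## §3 The trace form `a_ℓ(A(163)) ≡ ℓ⁴¹ + ℓ¹²² (mod 163)` -/

/-- **`a_ℓ(A(163)) ≡ ℓ⁴¹ + ℓ¹²² (mod 163)` for every prime `ℓ ≠ 163`** (the `ℓ`-th coefficient of `L(A(163), s)`; Buhler–Gross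
1985 (4.3) with `k = 122`, `p − k = 41`; `ρ̄_{A(163),163}^{ss} = ω⁴¹ ⊕ ω¹²²` in trace form), PROVED by the Mazur-1978 toolkit exactly
as cell `bsd-cm`'s (E49): `A(163)` is reducible at `163` (CM by `ℚ(√−163)`, `163` ramified), the isogeny character of the stable
line is unramified outside `163` hence `= χ̄₁₆₃ᵏ`, `a_q ≡ qᵏ + q·q⁻ᵏ` (Prop. 6.3 (1)), and `a₂ = 0` pins `k mod 162 ∈ {41, 122}`.
[cite: Mazur1978, §5 (p. 148) and Prop. 6.3 (1) (p. 153)] [cite: BuhlerGross1985, Ch. I (4.3) (p. 14)] -/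
theorem lFunction_cm163_mod (ℓ : ℕ) [hℓ : Fact ℓ.Prime] (h163 : ℓ ≠ 163) :
    (cm163.LFunction ℓ : ZMod 163) = (ℓ : ZMod 163) ^ 41 + (ℓ : ZMod 163) ^ 122 := by
  haveI : Fact (Nat.Prime 163) := ⟨by norm_num⟩
  haveI : NeZero ((163 : ℕ) : ℚ) := ⟨by norm_num⟩
  haveI : cm163.IsGloballyMinimal := P2.OddHeegnerTwists.isGloballyMinimal_cm163
  -- `A(163)[163]` is reducible: CM with `163 ∣ d_K = −163`
  have hCM : cm163.HasCM := hasCM_of_j_eq cm163 (Or.inr (Or.inr (Or.inr (Or.inr (Or.inr (Or.inr rfl)))))) j_cm163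
  have hred : ¬ cm163.HasIrreducibleModPGaloisRep 163 :=
    X12.not_irr_of_hasCM_of_dvd_cmFieldDiscrOfJ cm163 hCM 163 (by norm_num) (by rw [j_cm163]; norm_num [cmFieldDiscrOfJ])
  obtain ⟨H, hH, hcard⟩ :=
    (Mazur1978.not_hasIrreducibleModPGaloisRep_iff_exists_natCard_eq cm163 163).mp hred
  obtain ⟨P, hP0, rfl⟩ := Mazur1978.exists_eq_zmultiples_of_natCard_eq cm163 163 hcard
  have hst : ∀ σ : absoluteGaloisGroup ℚ, σ • P ∈ AddSubgroup.zmultiples P :=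
    fun σ => hH σ P (AddSubgroup.mem_zmultiples P)
  obtain ⟨r, hr⟩ := Mazur1978.exists_isogenyCharacter cm163 163 hP0 hst
  -- `r` is unramified outside `163`, hence `r = χ̄₁₆₃ᵏ`
  have hker := Mazur1978.isOpen_ker_of_smul_eq cm163 163 hP0 hr
  obtain ⟨k, -, hk⟩ := Mazur1978.exists_forall_eq_mul_modNCyclotomicCharacter_pow 163 r hker (n := 1)
    (fun v hv 𝔓 h𝔓 τ hτ => by
      rw [pow_one]
      exact Mazur1978.isogenyCharacter_eq_one_of_mem_inertia cm163 163 hP0 hr (hasGoodReductionAt_cm163 hv)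
        hv h𝔓 hτ)
  have hk' : ∀ σ : absoluteGaloisGroup ℚ, r σ = modNCyclotomicCharacter ℚ 163 σ ^ k := fun σ => by
    obtain ⟨b, hb, h⟩ := hk σ
    rw [pow_one] at hb
    rw [h, hb, one_mul]
  -- Mazur's Prop. 6.3 (1) at a good prime `q ≠ 163`: `a_q ≡ qᵏ + q·q⁻ᵏ`
  have key : ∀ (q : ℕ) [Fact q.Prime], q ≠ 163 →
      (cm163.frobeniusTrace q : ZMod 163) = (q : ZMod 163) ^ k + (q : ZMod 163) * ((q : ZMod 163) ^ k)⁻¹ := by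
    intro q hq hq163
    set v : HeightOneSpectrum (𝓞 ℚ) := (Rat.HeightOneSpectrum.primesEquiv (R := 𝓞 ℚ)).symm ⟨q, hq.out⟩
      with hvdef
    have hvq : (Rat.HeightOneSpectrum.primesEquiv v : ℕ) = q := by
      rw [hvdef, Equiv.apply_symm_apply]
    have hv : (q : 𝓞 ℚ) ∈ v.asIdeal := by
      rw [DeuringLadic.natCast_mem_asIdeal_iff, hvq]
    obtain ⟨𝔓, h𝔓⟩ := v.primesAbove_nonempty
    obtain ⟨φ, hφ⟩ := exists_isArithFrobAt_of_mem_primesAbove_holds (K := ℚ) (v := v) h𝔓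
    have hq' : ¬ q ∣ 163 := fun hd => hq163 ((Nat.prime_dvd_prime_iff_eq hq.out (by norm_num)).mp hd)
    have hχ : (modNCyclotomicCharacter ℚ 163 φ : ZMod 163) = q :=
      Rat.modNCyclotomicCharacter_of_isArithFrobAt hq.out hq' hv h𝔓 hφ
    have hmaz := Mazur1978.isogenyCharacter_add_div_eq_frobeniusTrace cm163 163 q hq163
      (hasGoodReductionAtPrime_cm163 q hq163) hP0 hr hv h𝔓 hφ
    rw [← hmaz, hk' φ, Units.val_inv_eq_inv_val, Units.val_pow_eq_pow_val, hχ]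
  -- polynomial form: `a_q = q^{k mod 162} + q·q^{161k mod 162}` (`y⁻¹ = y¹⁶¹`, `q¹⁶² = 1`)
  have key' : ∀ (q : ℕ) [Fact q.Prime], q ≠ 163 →
      (cm163.frobeniusTrace q : ZMod 163) =
        (q : ZMod 163) ^ (k % 162) + (q : ZMod 163) * (q : ZMod 163) ^ (161 * (k % 162) % 162) := by
    intro q hq hq163
    have hq0 : (q : ZMod 163) ≠ 0 := by
      rw [Ne, ZMod.natCast_eq_zero_iff]
      exact fun hd => hq163 ((Nat.prime_dvd_prime_iff_eq (by norm_num) hq.out).mp hd).symm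
    have h162 := natCast_pow_zmod163 hq.out hq163
    have he : k * 161 % 162 = 161 * (k % 162) % 162 := by omega
    rw [key q hq163, inv_eq_pow_zmod163 (pow_ne_zero k hq0), ← pow_mul, pow_eq_pow_mod k h162,
      pow_eq_pow_mod (k * 161) h162, he]
  -- `a₂(A(163)) = 0` pins `k mod 162 ∈ {41, 122}`
  haveI : Fact (Nat.Prime 2) := ⟨Nat.prime_two⟩
  have h₂ := key' 2 (by norm_num)
  rw [frobeniusTrace_cm163_two] at h₂
  push_cast at h₂
  have hk162 : k % 162 = 41 ∨ k % 162 = 122 :=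
    two_pow_add_eq_zero_cases_163 (k % 162) (Nat.mod_lt _ (by norm_num)) h₂.symm
  -- at `q = ℓ`
  rw [LFunction_apply_prime_eq_frobeniusTrace cm163 ℓ (hasGoodReductionAtPrime_cm163 ℓ h163), key' ℓ h163]
  rcases hk162 with h | h <;> rw [h] <;> ring

end Summit.BirchSwinnertonDyer.BirchSwinnertonDyer.Theorems.PrintCFram.AnchorReduction

end
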